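import Summits.CriticalPhenomena.CardyFormulaZ2.Theorems.CardySusyWardDiscretisationFamilyExistsLattice
import HarnessLib

/-!
# Local search at a chord: a valid cut edge next to a chord of the inner region — helper for `DiscretisationFamilyExists` (stmt-CriticalPhenomena-9644)

Walking from a deep inner face towards a marked point through inner faces across NON-CHORD sides
(sides whose endpoints are not both in `zdBoundary`), the first obstruction is either a non-inner
face — whose side is then a face-boundary edge, a candidate cut edge — or a CHORD: a side between
two inner faces with both endpoints boundary sites, which is not a valid cut edge (`IsZdAdmissible`
wants each `A`–`B` edge to border exactly one inner face).  This file proves that next to a chord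
there is always a face-boundary dart (`IsOutEdge`) within mesh distance `2δ`, whose inner (left)
face is the inner face `c` on our side of the chord or an inner face joined to `c` across a
non-chord side (`exists_isOutEdge_near_chord`), provided `c` has some inner neighbour across a
non-chord side (true along the walk).  Proof: a boundary site corners a non-inner face
(`not_mem_zdBoundary_of_forall_isInnerFace`); going around the far endpoint of the chord and, if
needed, around the next vertex, either a non-inner face adjacent to `c` or to a non-chord
neighbour of `c` appears, or all four sides of `c` are chords/face-boundary edges, contradicting
the hypothesis.  Also: the enumeration of the corners of `faceAt x k` and of the darts around a
face (`isCorner_faceAt_iff`, `eq_dart_of_faceAt_eq`).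
-/

noncomputable section

open Set Metric
open Literature.Probability.LatticeModels Literature.Probability.Percolation
  Literature.Probability.LatticeModels.DiscreteDobrushin

namespace Summit.CriticalPhenomena.CardyFormulaZ2.Theorems.DiscretisationFamilyExists

/-! ### Corners and darts of a face -/

/-- `cornerUnit (k + 3) = - cornerUnit (k + 1)`. [folklore] -/
theorem cornerUnit_add_three (k : Fin 4) : cornerUnit (k + 3) = -cornerUnit (k + 1) := by
  rw [show k + 3 = k + 1 + 2 by revert k; decide, cornerUnit_add_two]

/-- **The four corners of `faceAt x k`**: `x`, `x + cornerUnit k`, `x + cornerUnit (k + 1)` and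
the diagonal `x + cornerUnit k + cornerUnit (k + 1)`. [folklore] -/
theorem isCorner_faceAt_iff (v x : Site 2) (k : Fin 4) :
    IsCorner v (faceAt x k) ↔ v = x ∨ v = x + cornerUnit k ∨ v = x + cornerUnit (k + 1) ∨
      v = x + (cornerUnit k + cornerUnit (k + 1)) := by
  constructor
  · intro h
    rw [isCorner_iff] at h
    obtain ⟨d, rfl⟩ : ∃ d, v = x + d := ⟨v - x, by abel⟩
    have key : ∀ (d : Site 2) (k : Fin 4),
        (x + d = faceAt x k ∨ x + d = faceAt x k + Pi.single 0 1 ∨ x + d = faceAt x k + Pi.single 1 1 ∨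
          x + d = faceAt x k + Pi.single 0 1 + Pi.single 1 1) →
        (x + d = x ∨ x + d = x + cornerUnit k ∨ x + d = x + cornerUnit (k + 1) ∨
          x + d = x + (cornerUnit k + cornerUnit (k + 1))) := by
      intro d k h
      have h' : d = -cornerOff k ∨ d = -cornerOff k + Pi.single 0 1 ∨ d = -cornerOff k + Pi.single 1 1 ∨
          d = -cornerOff k + Pi.single 0 1 + Pi.single 1 1 := by
        simp only [faceAt, sub_eq_add_neg] at h
        rcases h with h | h | h | h
        · exact Or.inl (add_left_cancel (h.trans (by abel)))
        · exact Or.inr (Or.inl (add_left_cancel (h.trans (by abel))))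
        · exact Or.inr (Or.inr (Or.inl (add_left_cancel (h.trans (by abel)))))
        · exact Or.inr (Or.inr (Or.inr (add_left_cancel (h.trans (by abel)))))
      simp only [add_right_inj, add_eq_left]
      fin_cases k <;> rcases h' with rfl | rfl | rfl | rfl <;> decide
    exact key d k h
  · rintro (rfl | rfl | rfl | rfl)
    · exact isCorner_faceAt _ _
    · exact (isCorner_add_faceAt_iff x k k).2 (Or.inl rfl)
    · exact (isCorner_add_faceAt_iff x (k + 1) k).2 (Or.inr (fin4_add_one_add_three k).symm)
    · exact isCorner_add_diag_faceAt x k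

/-- The face `faceAt x k` seen from its four corners: it is face `k + 1` at `x + cornerUnit k`,
face `k + 3` at `x + cornerUnit (k + 1)`, face `k + 2` at the diagonal corner. [folklore] -/
theorem faceAt_eq_of_corner (x : Site 2) (k : Fin 4) :
    faceAt (x + cornerUnit k) (k + 1) = faceAt x k ∧
    faceAt (x + cornerUnit (k + 1)) (k + 3) = faceAt x k ∧
    faceAt (x + (cornerUnit k + cornerUnit (k + 1))) (k + 2) = faceAt x k := by
  refine ⟨faceAt_add_unit_succ x k, ?_, ?_⟩
  · have := faceAt_add_unit_add_two x (k + 1)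
    rw [fin4_add_one_add_two, fin4_add_one_add_three] at this
    exact this
  · rw [← add_assoc, ← fin4_add_one_add_one k, faceAt_add_unit_succ, faceAt_add_unit_succ]

/-- **The four darts around a face.** If `faceAt y k' = faceAt x k` then `(y, k')` is one of the
four presentations of the face from its corners. [folklore] -/
theorem eq_dart_of_faceAt_eq {x y : Site 2} {k k' : Fin 4} (h : faceAt y k' = faceAt x k) :
    (y = x ∧ k' = k) ∨ (y = x + cornerUnit k ∧ k' = k + 1) ∨
    (y = x + cornerUnit (k + 1) ∧ k' = k + 3) ∨ (y = x + (cornerUnit k + cornerUnit (k + 1)) ∧ k' = k + 2) := by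
  have hy : IsCorner y (faceAt x k) := h ▸ isCorner_faceAt y k'
  obtain ⟨h1, h3, h2⟩ := faceAt_eq_of_corner x k
  rcases (isCorner_faceAt_iff y x k).1 hy with rfl | rfl | rfl | rfl
  · exact Or.inl ⟨rfl, faceAt_injective _ h⟩
  · exact Or.inr (Or.inl ⟨rfl, faceAt_injective _ (h.trans h1.symm)⟩)
  · exact Or.inr (Or.inr (Or.inl ⟨rfl, faceAt_injective _ (h.trans h3.symm)⟩))
  · exact Or.inr (Or.inr (Or.inr ⟨rfl, faceAt_injective _ (h.trans h2.symm)⟩))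

/-- Some face at a boundary site is not inner (contrapositive of
`not_mem_zdBoundary_of_forall_isInnerFace`). [folklore] -/
theorem exists_not_isInnerFace_of_mem_zdBoundary {E : DiscreteDobrushin} {x : Site 2}
    (hx : x ∈ E.zdBoundary) : ∃ k, ¬ E.IsInnerFace (faceAt x k) := by
  by_contra h
  push Not at h
  exact not_mem_zdBoundary_of_forall_isInnerFace h hx

/-- Mesh distance of a lattice translate. [folklore] -/
theorem dist_meshPoint_add (δ : ℝ) (x d : Site 2) :
    dist (meshPoint δ (x + d)) (meshPoint δ x) = ‖meshPoint δ d‖ := by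
  rw [meshPoint_add, dist_eq_norm, add_sub_cancel_left]

/-- A unit-vector mesh offset has norm `|δ|`. [folklore] -/
theorem norm_meshPoint_cornerUnit (δ : ℝ) (k : Fin 4) : ‖meshPoint δ (cornerUnit k)‖ = |δ| := by
  have := dist_meshPoint_of_adj (δ := δ) (zdGraph_adj_add_cornerUnit (0 : Site 2) k)
  rwa [zero_add, dist_comm, dist_eq_norm, show meshPoint δ (0 : Site 2) = 0 by
    simp [meshPoint, Site.toComplex, Complex.ext_iff], sub_zero] at this

/-! ### The local search -/

/-- **A valid cut edge next to a chord.** Let the edge at the boundary site `x₁` in direction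
`j + 2` be a CHORD: its two faces `c = faceAt x₁ (j + 2)` and `faceAt x₁ (j + 1)` are inner and its
far endpoint `x₁ + cornerUnit (j + 2)` is a boundary site too.  If `c` has an inner neighbour
across a non-chord side (some dart `(y, k)` with `c` on its left, an inner face on its right and
not both endpoints in `zdBoundary`), then there is a face-boundary dart `(y, k)` (`IsOutEdge`:
inner face on the left, non-inner on the right) with `y` within mesh distance `2|δ|` of `x₁`,
whose left face is `c` itself or an inner neighbour of `c` across a non-chord side. [folklore] -/
theorem exists_isOutEdge_near_chord {E : DiscreteDobrushin} (x₁ : Site 2) (j : Fin 4)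
    (hc : E.IsInnerFace (faceAt x₁ (j + 2))) (hc' : E.IsInnerFace (faceAt x₁ (j + 1)))
    (hx₁ : x₁ ∈ E.zdBoundary) (hx₀ : x₁ + cornerUnit (j + 2) ∈ E.zdBoundary)
    (hnbr : ∃ (y : Site 2) (k : Fin 4), faceAt y k = faceAt x₁ (j + 2) ∧ E.IsInnerFace (faceAt y (k + 3)) ∧
        ¬ (y ∈ E.zdBoundary ∧ y + cornerUnit k ∈ E.zdBoundary)) :
    ∃ (y : Site 2) (k : Fin 4), E.IsOutEdge y k ∧ dist (meshPoint E.δ y) (meshPoint E.δ x₁) ≤ 2 * |E.δ| ∧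
      (faceAt y k = faceAt x₁ (j + 2) ∨
        ∃ (y' : Site 2) (k' : Fin 4), faceAt y' k' = faceAt x₁ (j + 2) ∧ faceAt y' (k' + 3) = faceAt y k ∧
          ¬ (y' ∈ E.zdBoundary ∧ y' + cornerUnit k' ∈ E.zdBoundary)) := by
  set B := E.zdBoundary with hB
  set c := faceAt x₁ (j + 2) with hcdef
  have hδ1 : |E.δ| ≤ 2 * |E.δ| := by linarith [abs_nonneg E.δ]
  -- the faces at `x₁`: `j+1`, `j+2` inner, so `j` or `j+3` is not
  obtain ⟨i, hi⟩ := exists_not_isInnerFace_of_mem_zdBoundary hx₁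
  have hi' : i = j ∨ i = j + 3 := by
    have : ∀ i j : Fin 4, i = j ∨ i = j + 1 ∨ i = j + 2 ∨ i = j + 3 := by decide
    rcases this i j with h | h | h | h
    · exact Or.inl h
    · exact absurd hc' (by rw [h] at hi; exact hi)
    · exact absurd hc (by rw [h] at hi; exact hi)
    · exact Or.inr h
  -- useful identities around `x₁` and `y := x₁ + cornerUnit (j+3)`
  set y := x₁ + cornerUnit (j + 3) with hy
  have e_c_y : faceAt y (j + 1) = c := by
    have := faceAt_add_unit_add_two x₁ (j + 3)
    rw [fin4_three_two, fin4_add_three_add_three] at this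
    exact this
  have e_f3_y : faceAt y j = faceAt x₁ (j + 3) := by
    have := faceAt_add_unit_succ x₁ (j + 3)
    rw [fin4_add_three_add_one] at this
    exact this
  rcases hi' with rfl | rfl
  · -- CASE B: face `i = j` at `x₁` not inner (and we do not know face `j+3` yet)
    by_cases h3 : E.IsInnerFace (faceAt x₁ (i + 3))
    · -- face `i+3` inner: the edge `(x₁, i+3)` separates `c` (right) from it; reverse dart `(y, i+1)`
      by_cases hyB : y ∈ B
      · -- the side `(x₁, i+3)` is a chord: go around `y`
        by_cases h2y : E.IsInnerFace (faceAt y (i + 2))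
        · -- face `i+2` at `y` inner: then face `i+3` at `y` is not
          obtain ⟨i', hi'⟩ := exists_not_isInnerFace_of_mem_zdBoundary hyB
          have hi3y : ¬ E.IsInnerFace (faceAt y (i + 3)) := by
            have : ∀ i' i : Fin 4, i' = i ∨ i' = i + 1 ∨ i' = i + 2 ∨ i' = i + 3 := by decide
            rcases this i' i with h | h | h | h
            · exact absurd (e_f3_y ▸ h3) (by rw [h] at hi'; exact hi')
            · exact absurd (e_c_y ▸ hc) (by rw [h] at hi'; exact hi')
            · exact absurd h2y (by rw [h] at hi'; exact hi')
            · rw [h] at hi'; exact hi'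
          set z := y + cornerUnit (i + 2) with hz
          by_cases hzB : z ∈ B
          · -- all four sides of `c` are chords: contradiction with `hnbr`
            exfalso
            obtain ⟨y₀, k₀, hyk, hinn, hnot⟩ := hnbr
            have hz' : z = x₁ + (cornerUnit (i + 2) + cornerUnit (i + 2 + 1)) := by
              rw [hz, hy, fin4_add_two_add_one, add_assoc, add_comm (cornerUnit (i + 3))]
            rcases eq_dart_of_faceAt_eq hyk with ⟨rfl, rfl⟩ | ⟨rfl, rfl⟩ | ⟨rfl, rfl⟩ | ⟨rfl, rfl⟩
            · exact hnot ⟨hx₁, hx₀⟩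
            · -- dart `(x₀, i+3)`: endpoints `x₀`, `x₀ + u(i+3) = z`
              refine hnot ⟨hx₀, ?_⟩
              rw [fin4_add_two_add_one]
              have : x₁ + cornerUnit (i + 2) + cornerUnit (i + 3) = z := by
                rw [hz, hy, add_assoc, add_assoc, add_comm (cornerUnit (i + 2))]
              rw [this]; exact hzB
            · -- dart `(y, i+1)`: endpoints `y`, `y + u(i+1) = x₁`
              refine hnot ⟨?_, ?_⟩
              · rw [fin4_add_two_add_one]; exact hyB
              · rw [fin4_add_two_add_one, fin4_add_two_add_three, add_assoc, cornerUnit_add_three,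
                  neg_add_cancel, add_zero]
                exact hx₁
            · -- dart `(z, i)`: endpoints `z`, `z + u i = y`
              refine hnot ⟨hz' ▸ hzB, ?_⟩
              rw [fin4_add_two_add_two', ← hz']
              have : z + cornerUnit i = y := by
                rw [hz, add_assoc, show cornerUnit (i + 2) + cornerUnit i = 0 by
                  rw [cornerUnit_add_two, neg_add_cancel], add_zero]
              rw [this]; exact hyB
          · -- `z ∉ B`: the side `(y, i+2)` is a non-chord; out-edge `(y + u(i+3), i+1)` with left face `faceAt y (i+2)`
            refine ⟨y + cornerUnit (i + 3), i + 1, ⟨?_, ?_⟩, ?_, Or.inr ⟨z, i, ?_, ?_, fun h => hzB h.1⟩⟩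
            · have := faceAt_add_unit_add_two y (i + 3)
              rw [fin4_three_two, fin4_add_three_add_three] at this
              rw [this]; exact h2y
            · have := faceAt_add_unit_succ y (i + 3)
              rw [fin4_add_three_add_one] at this
              rw [fin4_add_one_add_three, this]; exact hi3y
            · rw [hy, add_assoc, dist_meshPoint_add, meshPoint_add]
              calc ‖meshPoint E.δ (cornerUnit (i + 3)) + meshPoint E.δ (cornerUnit (i + 3))‖
                  ≤ ‖meshPoint E.δ (cornerUnit (i + 3))‖ + ‖meshPoint E.δ (cornerUnit (i + 3))‖ := norm_add_le _ _
                _ = 2 * |E.δ| := by rw [norm_meshPoint_cornerUnit]; ring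
            · have := faceAt_add_unit_add_two y (i + 2)
              rw [fin4_add_two_add_two', fin4_add_two_add_three] at this
              rw [this, e_c_y]
            · have h1 := faceAt_add_unit_succ y (i + 2)
              rw [fin4_add_two_add_one] at h1
              have h2 := faceAt_add_unit_add_two y (i + 3)
              rw [fin4_three_two, fin4_add_three_add_three] at h2
              rw [h1, h2]
        · -- face `i+2` at `y` not inner: out-edge `(y + cornerUnit (i+2), i)` with left face `c`
          refine ⟨y + cornerUnit (i + 2), i, ⟨?_, ?_⟩, ?_, Or.inl ?_⟩
          · have := faceAt_add_unit_add_two y (i + 2)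
            rw [fin4_add_two_add_two', fin4_add_two_add_three] at this
            rw [this, e_c_y]; exact hc
          · have := faceAt_add_unit_succ y (i + 2)
            rw [fin4_add_two_add_one] at this
            rw [this]; exact h2y
          · rw [hy, add_assoc, dist_meshPoint_add, meshPoint_add]
            calc ‖meshPoint E.δ (cornerUnit (i + 3)) + meshPoint E.δ (cornerUnit (i + 2))‖
                ≤ ‖meshPoint E.δ (cornerUnit (i + 3))‖ + ‖meshPoint E.δ (cornerUnit (i + 2))‖ := norm_add_le _ _
              _ = 2 * |E.δ| := by rw [norm_meshPoint_cornerUnit, norm_meshPoint_cornerUnit]; ring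
          · have := faceAt_add_unit_add_two y (i + 2)
            rw [fin4_add_two_add_two', fin4_add_two_add_three] at this
            rw [this, e_c_y]
      · -- `y ∉ B`: the side `(x₁, i+3)` is a non-chord; out-edge `(x₁ + u i, i+2)` with left face `faceAt x₁ (i+3)`
        refine ⟨x₁ + cornerUnit i, i + 2, ⟨?_, ?_⟩, ?_, Or.inr ⟨y, i + 1, e_c_y, ?_, fun h => hyB h.1⟩⟩
        · rw [faceAt_add_unit_add_two]; exact h3
        · rw [fin4_add_two_add_three, faceAt_add_unit_succ]; exact hi
        · rw [dist_meshPoint_add, norm_meshPoint_cornerUnit]; exact hδ1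
        · rw [fin4_add_one_add_three, e_f3_y, faceAt_add_unit_add_two]
    · -- face `i+3` at `x₁` not inner: out-edge `(y, i+1)` with left face `c`
      refine ⟨y, i + 1, ⟨e_c_y ▸ hc, ?_⟩, ?_, Or.inl e_c_y⟩
      · rw [fin4_add_one_add_three, e_f3_y]; exact h3
      · rw [hy, dist_meshPoint_add, norm_meshPoint_cornerUnit]; exact hδ1
  · -- CASE A: face `i = j+3` at `x₁` not inner: out-edge `(y, j+1)` with left face `c`
    refine ⟨y, j + 1, ⟨e_c_y ▸ hc, ?_⟩, ?_, Or.inl e_c_y⟩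
    · rw [fin4_add_one_add_three, e_f3_y]; exact hi
    · rw [hy, dist_meshPoint_add, norm_meshPoint_cornerUnit]; exact hδ1

end Summit.CriticalPhenomena.CardyFormulaZ2.Theorems.DiscretisationFamilyExists

end
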